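import Mathlib
import Summits.ValiantsHypothesis.ValiantsHypothesis.Theorems.BinomialElusiveToricBinomialElusive
import Summits.ValiantsHypothesis.ValiantsHypothesis.Theorems.NewtonUnitEquationsTwoProductsRaySeries
import Summits.ValiantsHypothesis.ValiantsHypothesis.Theorems.BinomialElusiveBinomialCandidateAffinePeeling

/-!
# Crux `BinomialElusive.BinomialCandidate` (stmt-ValiantsHypothesis-7392), line `registered` —
# helper for the stub `stub_integralPeeling`: the MONOMIAL corner (symbolic `ToricBinomialElusive`)

The registered stub `stub_integralPeeling` (integral half of the sibling crux `PeelingLemma`,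
stmt-ValiantsHypothesis-7391): a quadratic `Γ : ℂ^{m-1} → ℂ^m` with a power-series solution `p` of
`Γ(p) = (t^{N a_i} + t^{N b_i})_i` forces a nonzero integer relation among the `2m` exponents of
length `≤ ⌊log₂ m⌋²`.

This file settles the corner where every coordinate `Γ_i` is a MONOMIAL `κ_i y^{e_i}` (of any
degree, in any number `n < m` of variables, for any LAURENT solution): it is the symbolic form of the
route's proved support `ToricBinomialElusive` (stmt-7394, pointwise containment), with the same
cyclotomic test point.

* `monomial_no_solution` — for exponent data `a_i < a_i + c_i` with pairwise distinct positive gaps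
  `c_i`, NO Laurent solution exists.  Proof: `Γ_i(p) = κ_i ∏_j p_j^{e_ij} = T_i := t^{N a_i}(1 + t^{N c_i})`
  forces `κ_i ≠ 0`; an integer left-kernel vector `λ ≠ 0` of the `m × n` exponent matrix
  (`exists_ne_zero_int_leftKernel`, strong rank condition) gives, WITHOUT division,
  `C(k⁻) ∏_i T_i^{λ⁺_i} = C(k⁺) ∏_i T_i^{λ⁻_i}` with `k^± = ∏ κ_i^{λ^±_i} ≠ 0` (both sides equal
  `C(k⁺ k⁻) ∏_j p_j^{v_j}`, `v_j = Σ_i e_ij λ⁺_i = Σ_i e_ij λ⁻_i`).  The `T_i` are polynomials and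
  `ℂ[X] → ℂ((t))` is injective, so this is an identity in `ℂ[X]`; evaluate it at
  `ζ = exp(π I / (N c_{i₁}))`, `i₁` the maximiser of `c` on `supp λ` with `λ_{i₁} > 0`: the left side
  vanishes (`1 + ζ^{N c_{i₁}} = 0`), the right side does not (`0 < N c_i < N c_{i₁}` for `λ_i < 0`, so
  `Im ζ^{N c_i} > 0`).
* `integralPeeling_monomial` — the stub's statement with `(Γ i).support.card ≤ 1` in place of
  `totalDegree ≤ 2` (explicit threshold `m ≥ 4`, no integrality, no degree bound): degenerate data and
  equal gaps `|a_i - b_i| = |a_j - b_j|` (`i ≠ j`) are relations of length `≤ 4 ≤ ⌊log₂ m⌋²`; otherwise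
  `monomial_no_solution` applies after sorting each pair `(a_i, b_i)`.

Sources: Garg–Makam–Oliveira–Wigderson 2019 (arXiv:1904.04299) Prop. 9.8 (monomial curves versus
monomial substitutions); multiplicative independence of `1 + x^c` (folklore); the tree's
`BinomialElusiveToricBinomialElusive` (test point and kernel vector reused verbatim).  NOT here:
coordinates `Γ_i` with two or more monomials (the open content of the stub).
-/

-- layout Summits/ValiantsHypothesis/ValiantsHypothesis forces the duplicated namespace component
set_option linter.dupNamespace false

namespace Summit.ValiantsHypothesis.ValiantsHypothesis.Theorems.BinomialCandidateStubs

open scoped BigOperators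
open Polynomial (C X)
open Summit.ValiantsHypothesis.ValiantsHypothesis.Theorems.BinomialElusiveToricBinomialElusive
  (exists_ne_zero_int_leftKernel exp_pi_mul_I_div_pow_self one_add_exp_pow_ne_zero)
open Summit.ValiantsHypothesis.ValiantsHypothesis.Theorems.TwoProducts.RaySeries
  (exists_eq_monomial_of_card_support_le_one)

namespace MonomialPeeling

/-- Product bookkeeping in a commutative monoid: `∏_i (κ_i ∏_j y_j^{e_ij})^{n_i} =
(∏_i κ_i^{n_i}) ∏_j y_j^{∑_i e_ij n_i}`. -/
-- adapted from Theorems/BinomialElusiveToricBinomialElusive.lean (`prod_monomial_pow`, stated there over `ℂ`)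
theorem prod_monomial_pow' {M : Type*} [CommMonoid M] {m s : ℕ} (κ : Fin m → M) (e : Fin m → Fin s → ℕ)
    (y : Fin s → M) (n : Fin m → ℕ) :
    ∏ i, (κ i * ∏ j, y j ^ e i j) ^ n i = (∏ i, κ i ^ n i) * ∏ j, y j ^ (∑ i, e i j * n i) := by
  calc ∏ i, (κ i * ∏ j, y j ^ e i j) ^ n i
      = ∏ i, (κ i ^ n i * ∏ j, y j ^ (e i j * n i)) := by
        refine Finset.prod_congr rfl fun i _ => ?_
        rw [mul_pow, ← Finset.prod_pow]
        refine congrArg _ (Finset.prod_congr rfl fun j _ => ?_)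
        rw [pow_mul]
    _ = (∏ i, κ i ^ n i) * ∏ i, ∏ j, y j ^ (e i j * n i) := Finset.prod_mul_distrib
    _ = (∏ i, κ i ^ n i) * ∏ j, y j ^ (∑ i, e i j * n i) := by
        rw [Finset.prod_comm]
        refine congrArg _ (Finset.prod_congr rfl fun j _ => ?_)
        rw [Finset.prod_pow_eq_pow_sum]

/-- The embedding `ℂ[X] → ℂ((t))` sends `X^k` to `t^k = single k 1`. -/
theorem algebraMap_X_pow (k : ℕ) :
    algebraMap (Polynomial ℂ) (LaurentSeries ℂ) (X ^ k) = HahnSeries.single (k : ℤ) (1 : ℂ) := by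
  rw [Polynomial.algebraMap_hahnSeries_apply, Polynomial.coe_pow, Polynomial.coe_X,
    HahnSeries.ofPowerSeries_X_pow]

/-- The embedding `ℂ[X] → ℂ((t))` sends `C k` to the constant series `HahnSeries.C k`. -/
theorem algebraMap_C (k : ℂ) :
    algebraMap (Polynomial ℂ) (LaurentSeries ℂ) (C k) = HahnSeries.C k := by
  rw [Polynomial.algebraMap_hahnSeries_apply, Polynomial.coe_C, HahnSeries.ofPowerSeries_C]

/-- The cyclotomic evaluation step: an identity `k⁻ ∏_i F_i(ζ)^{λ⁺_i} = k⁺ ∏_i F_i(ζ)^{λ⁻_i}` with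
`k⁺ ≠ 0`, `F_i(x) = x^{N a_i} + x^{N(a_i + c_i)}`, `ζ = exp(π I/(N c_{i₁}))`, `λ_{i₁} > 0` and `c`
maximal on `supp λ` at `i₁` (gaps injective and positive) is absurd. -/
theorem eval_identity_false {m : ℕ} (a c : Fin m → ℕ) (hc : ∀ i, 0 < c i) (hcinj : Function.Injective c)
    {N : ℕ} (hN : 0 < N) (l : Fin m → ℤ) (i₁ : Fin m) (hi₁ : 0 < l i₁)
    (hmax : ∀ i, l i ≠ 0 → c i ≤ c i₁) (kp km : ℂ) (hkp : kp ≠ 0)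
    (hid : km * ∏ i, (Complex.exp (Real.pi * Complex.I / ((N * c i₁ : ℕ) : ℂ)) ^ (N * a i) +
        Complex.exp (Real.pi * Complex.I / ((N * c i₁ : ℕ) : ℂ)) ^ (N * (a i + c i))) ^ (l i).toNat =
      kp * ∏ i, (Complex.exp (Real.pi * Complex.I / ((N * c i₁ : ℕ) : ℂ)) ^ (N * a i) +
        Complex.exp (Real.pi * Complex.I / ((N * c i₁ : ℕ) : ℂ)) ^ (N * (a i + c i))) ^ (-l i).toNat) :
    False := by
  set ζ : ℂ := Complex.exp (Real.pi * Complex.I / ((N * c i₁ : ℕ) : ℂ)) with hζ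
  have hζne : ζ ≠ 0 := Complex.exp_ne_zero _
  have hfac : ∀ i, ζ ^ (N * a i) + ζ ^ (N * (a i + c i)) = ζ ^ (N * a i) * (1 + ζ ^ (N * c i)) := by
    intro i; rw [Nat.mul_add, pow_add]; ring
  have hfi₁ : ζ ^ (N * a i₁) + ζ ^ (N * (a i₁ + c i₁)) = 0 := by
    rw [hfac, hζ, exp_pi_mul_I_div_pow_self (Nat.mul_pos hN (hc i₁))]; ring
  have hfne : ∀ i, l i < 0 → ζ ^ (N * a i) + ζ ^ (N * (a i + c i)) ≠ 0 := by
    intro i hi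
    have hne1 : i ≠ i₁ := fun h => by subst h; exact lt_asymm hi hi₁
    have hlt : c i < c i₁ := lt_of_le_of_ne (hmax i hi.ne) fun h => hne1 (hcinj h)
    rw [hfac]
    refine mul_ne_zero (pow_ne_zero _ hζne) ?_
    rw [hζ]
    exact one_add_exp_pow_ne_zero (Nat.mul_pos hN (hc i)) (Nat.mul_lt_mul_of_pos_left hlt hN)
  have hplus : ∏ i, (ζ ^ (N * a i) + ζ ^ (N * (a i + c i))) ^ (l i).toNat = 0 := by
    apply Finset.prod_eq_zero (Finset.mem_univ i₁)
    rw [hfi₁, zero_pow]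
    have : 0 < (l i₁).toNat := Int.lt_toNat.mpr (by simpa using hi₁)
    exact this.ne'
  have hminus : ∏ i, (ζ ^ (N * a i) + ζ ^ (N * (a i + c i))) ^ (-l i).toNat ≠ 0 := by
    rw [Finset.prod_ne_zero_iff]
    intro i _
    by_cases hi : l i < 0
    · exact pow_ne_zero _ (hfne i hi)
    · have h0 : (-l i).toNat = 0 := by rw [Int.toNat_eq_zero]; omega
      rw [h0, pow_zero]; exact one_ne_zero
  rw [hplus, mul_zero] at hid
  exact mul_ne_zero hkp hminus hid.symm

/-- **The monomial corner, sorted data.**  With `n < m` variables, positive pairwise distinct gaps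
`c_i`, and every `Γ_i` a monomial (`(Γ i).support.card ≤ 1`, any degree), the system
`Γ(p) = (t^{N a_i} + t^{N (a_i + c_i)})_i` has NO Laurent series solution. -/
theorem monomial_no_solution {m n : ℕ} (hnm : n < m) (a c : Fin m → ℕ) (hc : ∀ i, 0 < c i)
    (hcinj : Function.Injective c) (Γ : Fin m → MvPolynomial (Fin n) ℂ)
    (hΓ : ∀ i, (Γ i).support.card ≤ 1) (N : ℕ) (hN : 0 < N) (p : Fin n → LaurentSeries ℂ)
    (hp : ∀ i, MvPolynomial.aeval p (Γ i) =
      HahnSeries.single ((N * a i : ℕ) : ℤ) (1 : ℂ) +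
        HahnSeries.single ((N * (a i + c i) : ℕ) : ℤ) (1 : ℂ)) : False := by
  classical
  -- monomial normal form `Γ_i = κ_i y^{e_i}` and `Γ_i(p) = C κ_i * ∏_j p_j^{e_ij}`
  choose e κ hΓe using fun i => exists_eq_monomial_of_card_support_le_one (Γ i) (hΓ i)
  set ι : Polynomial ℂ →+* LaurentSeries ℂ := algebraMap (Polynomial ℂ) (LaurentSeries ℂ) with hι
  have hιinj : Function.Injective ι := Polynomial.algebraMap_hahnSeries_injective ℤ
  set F : Fin m → Polynomial ℂ := fun i => X ^ (N * a i) + X ^ (N * (a i + c i)) with hF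
  have hT : ∀ i, ι (F i) = HahnSeries.single ((N * a i : ℕ) : ℤ) (1 : ℂ) +
      HahnSeries.single ((N * (a i + c i) : ℕ) : ℤ) (1 : ℂ) := fun i => by
    simp only [hF, hι, map_add, algebraMap_X_pow]
  have heval : ∀ i, ι (F i) = HahnSeries.C (κ i) * ∏ j, p j ^ e i j := fun i => by
    rw [hT i, ← hp i, hΓe i, MvPolynomial.aeval_monomial, Finsupp.prod_fintype _ _ (fun j => pow_zero _),
      AffinePeeling.algebraMap_laurentSeries_apply, HahnSeries.C_apply]
  -- nonzero coefficients
  have hF1 : ∀ i, Polynomial.eval 1 (F i) = 2 := fun i => by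
    simp only [hF, Polynomial.eval_add, Polynomial.eval_pow, Polynomial.eval_X, one_pow]; norm_num
  have hκ : ∀ i, κ i ≠ 0 := by
    intro i h0
    have h1 : ι (F i) = 0 := by rw [heval i, h0, HahnSeries.C_zero, zero_mul]
    have h2 : F i = 0 := hιinj (by rw [h1, map_zero])
    have h3 := hF1 i
    rw [h2, Polynomial.eval_zero] at h3
    norm_num at h3
  -- integer left-kernel vector and the sign split `λ = λ⁺ - λ⁻`
  obtain ⟨l, hlne, hlker⟩ := exists_ne_zero_int_leftKernel hnm (fun i j => e i j)
  have hv : ∀ j, ∑ i, e i j * (l i).toNat = ∑ i, e i j * (-l i).toNat := by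
    intro j
    have h2 : ∑ i, ((e i j : ℤ) * ((l i).toNat : ℤ) - (e i j : ℤ) * ((-l i).toNat : ℤ)) = 0 := by
      rw [← hlker j]
      refine Finset.sum_congr rfl fun i _ => ?_
      rw [← mul_sub, Int.toNat_sub_toNat_neg, mul_comm]
    rw [Finset.sum_sub_distrib, sub_eq_zero] at h2
    exact_mod_cast h2
  -- the division-free identity `C k⁻ ∏ T_i^{λ⁺_i} = C k⁺ ∏ T_i^{λ⁻_i}` in `ℂ((t))`
  set kp : ℂ := ∏ i, κ i ^ (l i).toNat with hkp
  set km : ℂ := ∏ i, κ i ^ (-l i).toNat with hkm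
  have hside : ∀ nn : Fin m → ℕ, ∏ i, ι (F i) ^ nn i =
      HahnSeries.C (∏ i, κ i ^ nn i) * ∏ j, p j ^ (∑ i, e i j * nn i) := fun nn => by
    simp only [heval]
    rw [prod_monomial_pow', map_prod]
    simp only [map_pow]
  have hidL : HahnSeries.C km * ∏ i, ι (F i) ^ (l i).toNat =
      HahnSeries.C kp * ∏ i, ι (F i) ^ (-l i).toNat := by
    rw [hside, hside, ← mul_assoc, ← mul_assoc, ← map_mul, ← map_mul, mul_comm km kp]
    congr 2
    funext j
    rw [hv j]
  -- pull back to `ℂ[X]`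
  have hidP : C km * ∏ i, F i ^ (l i).toNat = C kp * ∏ i, F i ^ (-l i).toNat := by
    apply hιinj
    simp only [map_mul, map_prod, map_pow, hι, algebraMap_C]
    simpa only [hι] using hidL
  -- maximiser of `c` on `supp λ`, with positive sign after `λ ↦ -λ` if needed
  have hne : (Finset.univ.filter fun i => l i ≠ 0).Nonempty := by
    obtain ⟨i, hi⟩ := Function.ne_iff.mp hlne
    exact ⟨i, Finset.mem_filter.mpr ⟨Finset.mem_univ i, hi⟩⟩
  obtain ⟨i₁, hi₁mem, hi₁max⟩ := Finset.exists_max_image _ c hne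
  have hl₁ : l i₁ ≠ 0 := (Finset.mem_filter.mp hi₁mem).2
  have hmax : ∀ i, l i ≠ 0 → c i ≤ c i₁ := fun i hi =>
    hi₁max i (Finset.mem_filter.mpr ⟨Finset.mem_univ i, hi⟩)
  have hkp0 : kp ≠ 0 := Finset.prod_ne_zero_iff.mpr fun i _ => pow_ne_zero _ (hκ i)
  have hkm0 : km ≠ 0 := Finset.prod_ne_zero_iff.mpr fun i _ => pow_ne_zero _ (hκ i)
  -- evaluate the polynomial identity at the test point
  set ζ : ℂ := Complex.exp (Real.pi * Complex.I / ((N * c i₁ : ℕ) : ℂ)) with hζ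
  have hevF : ∀ i, Polynomial.eval ζ (F i) = ζ ^ (N * a i) + ζ ^ (N * (a i + c i)) := fun i => by
    simp only [hF, Polynomial.eval_add, Polynomial.eval_pow, Polynomial.eval_X]
  have hev := congr_arg (Polynomial.eval ζ) hidP
  simp only [Polynomial.eval_mul, Polynomial.eval_C, Polynomial.eval_prod, Polynomial.eval_pow, hevF] at hev
  rcases lt_or_gt_of_ne hl₁ with hneg | hpos
  · -- use `-λ`: swap the two sides
    refine eval_identity_false a c hc hcinj hN (-l) i₁ (by simpa using hneg)
      (fun i hi => hmax i (by simpa using hi)) km kp hkm0 ?_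
    simp only [Pi.neg_apply, neg_neg]
    exact hev.symm
  · exact eval_identity_false a c hc hcinj hN l i₁ hpos hmax kp km hkp0 hev

/-! ## Equal gaps: a relation of length `4` -/

/-- A signed coincidence of two gaps, `s (a_i - b_i) + t (a_j - b_j) = 0` with `|s| = |t| = 1` and
`i ≠ j`, is a relation of length `4 ≤ ⌊log₂ m⌋²` (`m ≥ 4`). -/
theorem shortRelation_of_gap_rel {m : ℕ} (hm : 4 ≤ m) (a b : Fin m → ℕ) {i j : Fin m} (hij : i ≠ j)
    (s t : ℤ) (hs : |s| = 1) (ht : |t| = 1)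
    (h : s * ((a i : ℤ) - b i) + t * ((a j : ℤ) - b j) = 0) :
    ∃ u v : Fin m → ℤ, (u, v) ≠ 0 ∧ ∑ i, (|u i| + |v i|) ≤ ((Nat.log 2 m ^ 2 : ℕ) : ℤ) ∧
      ∑ i, (u i * (a i : ℤ) + v i * (b i : ℤ)) = 0 := by
  classical
  have hs0 : s ≠ 0 := fun h0 => by simp [h0] at hs
  refine ⟨Pi.single i s + Pi.single j t, -(Pi.single i s + Pi.single j t), ?_, ?_, ?_⟩
  · intro h0
    have := congr_arg (fun q : (Fin m → ℤ) × (Fin m → ℤ) => q.1 i) h0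
    simp [hij, hs0] at this
  · have h4 : (4 : ℤ) ≤ ((Nat.log 2 m ^ 2 : ℕ) : ℤ) := by
      have h2 : 2 ≤ Nat.log 2 m := Nat.le_log_of_pow_le (by norm_num) (by simpa using hm)
      have : 4 ≤ Nat.log 2 m ^ 2 := by nlinarith
      exact_mod_cast this
    refine le_trans ?_ h4
    have hsum : ∀ k, |(Pi.single i s + Pi.single j t : Fin m → ℤ) k| ≤
        |(Pi.single i s : Fin m → ℤ) k| + |(Pi.single j t : Fin m → ℤ) k| := fun k => abs_add_le _ _
    have h1 : ∑ k, |(Pi.single i s : Fin m → ℤ) k| = 1 := by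
      simp [Pi.single_apply, apply_ite abs, hs]
    have h2 : ∑ k, |(Pi.single j t : Fin m → ℤ) k| = 1 := by
      simp [Pi.single_apply, apply_ite abs, ht]
    calc ∑ k, (|(Pi.single i s + Pi.single j t : Fin m → ℤ) k| +
          |(-(Pi.single i s + Pi.single j t) : Fin m → ℤ) k|)
        = 2 * ∑ k, |(Pi.single i s + Pi.single j t : Fin m → ℤ) k| := by
          rw [two_mul, Finset.sum_add_distrib]
          simp only [Pi.neg_apply, abs_neg]
      _ ≤ 2 * ∑ k, (|(Pi.single i s : Fin m → ℤ) k| + |(Pi.single j t : Fin m → ℤ) k|) := by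
          gcongr with k
          exact hsum k
      _ = 4 := by rw [Finset.sum_add_distrib, h1, h2]; norm_num
  · have : ∑ k, ((Pi.single i s + Pi.single j t : Fin m → ℤ) k * (a k : ℤ) +
        (-(Pi.single i s + Pi.single j t) : Fin m → ℤ) k * (b k : ℤ)) =
        s * ((a i : ℤ) - b i) + t * ((a j : ℤ) - b j) := by
      simp [Pi.single_apply, add_mul, ite_mul, Finset.sum_add_distrib, sub_eq_add_neg, mul_add,
        mul_neg, neg_mul]
      ring
    rw [this, h]

/-- The gap `max - min` of a pair of naturals, cast to `ℤ`, is `|a - b|`. -/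
theorem cast_max_sub_min (x y : ℕ) : ((max x y - min x y : ℕ) : ℤ) = |(x : ℤ) - y| := by
  rcases le_total x y with h | h
  · rw [max_eq_right h, min_eq_left h, Nat.cast_sub h, abs_sub_comm, abs_of_nonneg (by omega)]
  · rw [max_eq_left h, min_eq_right h, Nat.cast_sub h, abs_of_nonneg (by omega)]

/-- Sorting a pair: `t^{N a} + t^{N b} = t^{N min} + t^{N (min + (max - min))}`. -/
theorem binomial_sorted (N a b : ℕ) :
    HahnSeries.single ((N * a : ℕ) : ℤ) (1 : ℂ) + HahnSeries.single ((N * b : ℕ) : ℤ) (1 : ℂ) =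
      HahnSeries.single ((N * min a b : ℕ) : ℤ) (1 : ℂ) +
        HahnSeries.single ((N * (min a b + (max a b - min a b)) : ℕ) : ℤ) (1 : ℂ) := by
  rw [Nat.add_sub_cancel' (min_le_max : min a b ≤ max a b)]
  rcases le_total a b with h | h
  · rw [min_eq_left h, max_eq_right h]
  · rw [min_eq_right h, max_eq_left h, add_comm]

end MonomialPeeling

/-- **`stub_integralPeeling`, monomial corner** (uniform in `m ≥ 4`; no integrality and no degree
bound needed): the registered stub's statement with "each `Γ i` has at most one monomial" in place
of `totalDegree ≤ 2`.  Degenerate data give a relation of length `2`, equal gaps one of length `4`,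
and otherwise a monomial `Γ` on `m - 1 < m` variables has no Laurent solution
(`MonomialPeeling.monomial_no_solution`). -/
theorem integralPeeling_monomial :
    ∀ m ≥ 4, ∀ (a b : Fin m → ℕ) (Γ : Fin m → MvPolynomial (Fin (m - 1)) ℂ) (N : ℕ)
      (p : Fin (m - 1) → LaurentSeries ℂ), (∀ i, (Γ i).support.card ≤ 1) → 0 < N →
      (∀ i, MvPolynomial.aeval p (Γ i) =
        HahnSeries.single ((N * a i : ℕ) : ℤ) (1 : ℂ) + HahnSeries.single ((N * b i : ℕ) : ℤ) (1 : ℂ)) →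
      ∃ u v : Fin m → ℤ, (u, v) ≠ 0 ∧ ∑ i, (|u i| + |v i|) ≤ ((Nat.log 2 m ^ 2 : ℕ) : ℤ) ∧
        ∑ i, (u i * (a i : ℤ) + v i * (b i : ℤ)) = 0 := by
  intro m hm a b Γ N p hΓ hN hp
  classical
  by_cases hab : Function.Injective (Sum.elim a b)
  swap
  · exact AffinePeeling.shortRelation_of_not_injective hm a b hab
  obtain ⟨-, -, hab'⟩ := Sum.elim_injective.mp hab
  -- sorted data: `lo i = min`, gap `c i = max - min > 0`
  set lo : Fin m → ℕ := fun i => min (a i) (b i) with hlo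
  set c : Fin m → ℕ := fun i => max (a i) (b i) - min (a i) (b i) with hc
  have hcpos : ∀ i, 0 < c i := by
    intro i
    have : a i ≠ b i := hab' i i
    simp only [hc]
    rcases lt_or_gt_of_ne this with h | h
    · rw [max_eq_right h.le, min_eq_left h.le]; omega
    · rw [max_eq_left h.le, min_eq_right h.le]; omega
  by_cases hcinj : Function.Injective c
  · -- generic case: no solution at all
    refine (MonomialPeeling.monomial_no_solution (by omega) lo c hcpos hcinj Γ hΓ N hN p
      fun i => ?_).elim
    rw [hp i, MonomialPeeling.binomial_sorted]
  · -- equal gaps: a relation of length 4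
    obtain ⟨i, j, hcij, hij⟩ := Function.not_injective_iff.mp hcinj
    have hzz : |(a i : ℤ) - b i| = |(a j : ℤ) - b j| := by
      rw [← MonomialPeeling.cast_max_sub_min, ← MonomialPeeling.cast_max_sub_min]
      exact_mod_cast hcij
    rcases abs_eq_abs.mp hzz with h | h
    · exact MonomialPeeling.shortRelation_of_gap_rel hm a b hij 1 (-1) (by simp) (by simp)
        (by rw [h]; ring)
    · exact MonomialPeeling.shortRelation_of_gap_rel hm a b hij 1 1 (by simp) (by simp)
        (by rw [h]; ring)

end Summit.ValiantsHypothesis.ValiantsHypothesis.Theorems.BinomialCandidateStubs
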